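import Mathlib
import Summits.AtomisticToContinuum.FouriersLaw.Theorems.EmbeddedDrudeMourreMourreDissolutionFibreTwoZeroFloorNearZero
import Summits.AtomisticToContinuum.FouriersLaw.Theorems.EmbeddedDrudeMourreMourreDissolutionSheetTransversal
import Summits.AtomisticToContinuum.FouriersLaw.Theorems.EmbeddedDrudeMourreMourreDissolutionResonanceFactorisation
import Summits.AtomisticToContinuum.FouriersLaw.Theorems.EmbeddedDrudeMourreMourreDissolutionBracketModulus
import Summits.AtomisticToContinuum.FouriersLaw.Theorems.EmbeddedDrudeMourreFGRGapBranchA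
import HarnessLib

/-!
# `MourreDissolution`, line `swap-odd-threshold-rigidity`, stub TZ `stub_fibreTwoZeroFloor` — part B (periodicity, the factor `D`, zeros of `H`)

Helper file (supports crux item `stmt-AtomisticToContinuum-12594`, route `EmbeddedDrudeMourre`,
sub-problem `FouriersLaw`; lead c8). THE UNIFORM TWO-ZERO FLOOR of the resonance function `Ω(k₁,k₂,k₃)`
of the pinned phonon band along its `k₂`-fibres: for `ω₂ > 0` there is `m > 0` such that on every
non-degenerate fibre (`sin((k₃−k₁)/2) ≠ 0`, `ω′(k₃) ≠ ω′(k₁)`) some point `kt` satisfies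
`|Ω(k₁,k₂,k₃)| ≥ m |sin((k₃−k₁)/2) sin((k₂−k₃)/2) sin((k₂−kt)/2)|` for all real `k₂`.

Proof: by the global factorisation `Ω·D = 8 sin((k₃−k₁)/2) sin((k₂−k₃)/2)·H` (I1) it suffices to bound
`|H|` below by `η|sin((k₂−kt)/2)|` with `kt` a zero of `H(k₁,·,k₃)`; a zero exists (`H` is
`2π`-antiperiodic in `k₂`), all zeros of `H` on a non-degenerate fibre are congruent mod `2π` (they are
zeros of `Ω`; a zero at `k₃` is excluded by the velocity identity of TA; then
`FGRGap…Branch.two_classes`), and the compactness floor `|H| < η ⇒ |G| ≥ η` (part A, from TA ∧ TB)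
together with the near-zero lemma of part A puts every point with `|H| < η` within `|H|/η` of a zero.
Periodicity reduces general momenta to the box `[−π,π]³`.

References: Aoki–Lukkarinen–Spohn 2006 §4; Lukkarinen 2016 §2.2.4 (the branch `h`); folklore.
-/

noncomputable section

open Set Real

namespace Summit.AtomisticToContinuum.FouriersLaw.Theorems.MourreDissolution

open Literature.MathematicalPhysics.KineticTheory.PhononBoltzmann

/-! ## 1. Periodicity bookkeeping -/

/-- `H(k₁, k₂ + 2π, k₃) = −H(k₁,k₂,k₃)`: the sheet function is `2π`-antiperiodic in `k₂`. [folklore] -/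
theorem fibreTwoZeroFloor_sheet_add_two_pi (ω₂ k₁ k₂ k₃ : ℝ) :
    ((dispersion ω₂ k₁ * dispersion ω₂ (k₂ + 2 * π) + dispersion ω₂ k₃ * dispersion ω₂ (k₁ + (k₂ + 2 * π) - k₃) +
              2 * (ω₂ + 2)) * Real.cos ((k₁ + (k₂ + 2 * π)) / 2) -
          4 * Real.cos ((k₃ - k₁) / 2) * Real.cos (((k₂ + 2 * π) - k₃) / 2)) =
      -((dispersion ω₂ k₁ * dispersion ω₂ k₂ + dispersion ω₂ k₃ * dispersion ω₂ (k₁ + k₂ - k₃) +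
              2 * (ω₂ + 2)) * Real.cos ((k₁ + k₂) / 2) -
          4 * Real.cos ((k₃ - k₁) / 2) * Real.cos ((k₂ - k₃) / 2)) := by
  rw [show k₁ + (k₂ + 2 * π) - k₃ = k₁ + k₂ - k₃ + 2 * π by ring, dispersion_periodic, dispersion_periodic,
    show (k₁ + (k₂ + 2 * π)) / 2 = (k₁ + k₂) / 2 + π by ring, Real.cos_add_pi,
    show (k₂ + 2 * π - k₃) / 2 = (k₂ - k₃) / 2 + π by ring, Real.cos_add_pi]
  ring

/-- `|H(k₁, ·, k₃)|` is `2π`-periodic. [folklore] -/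
theorem fibreTwoZeroFloor_abs_sheet_periodic (ω₂ k₁ k₃ : ℝ) :
    Function.Periodic (fun q : ℝ =>
      |((dispersion ω₂ k₁ * dispersion ω₂ q + dispersion ω₂ k₃ * dispersion ω₂ (k₁ + q - k₃) +
              2 * (ω₂ + 2)) * Real.cos ((k₁ + q) / 2) -
          4 * Real.cos ((k₃ - k₁) / 2) * Real.cos ((q - k₃) / 2))|) (2 * π) := by
  intro q
  simp only
  rw [fibreTwoZeroFloor_sheet_add_two_pi, abs_neg]

/-- `Ω` is `2π`-periodic in `k₁`. [folklore] -/
theorem fibreTwoZeroFloor_resonanceFn_periodic₁ (ω₂ k₂ k₃ : ℝ) :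
    Function.Periodic (fun q : ℝ => resonanceFn ω₂ q k₂ k₃) (2 * π) := fun q => by
  simp only; exact resonanceFn_add_two_pi ω₂ q k₂ k₃

/-- `Ω` is `2π`-periodic in `k₂`. [folklore] -/
theorem fibreTwoZeroFloor_resonanceFn_periodic₂ (ω₂ k₁ k₃ : ℝ) :
    Function.Periodic (fun q : ℝ => resonanceFn ω₂ k₁ q k₃) (2 * π) := fun q => by
  simp only; exact FGRGap.FoldJetRigidity.Branch.resonanceFn_add_two_pi₂ ω₂ k₁ q k₃

/-- `Ω` is `2π`-periodic in `k₃`. [folklore] -/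
theorem fibreTwoZeroFloor_resonanceFn_periodic₃ (ω₂ k₁ k₂ : ℝ) :
    Function.Periodic (fun q : ℝ => resonanceFn ω₂ k₁ k₂ q) (2 * π) := fun q => by
  simp only [resonanceFn]
  rw [dispersion_periodic, show k₁ + k₂ - (q + 2 * π) = k₁ + k₂ - q - 2 * π by ring,
    (dispersion_periodic ω₂).sub_eq]

/-- The group velocity is `2π`-periodic (as a `Function.Periodic` statement). [folklore] -/
theorem fibreTwoZeroFloor_groupVelocity_periodic (ω₂ : ℝ) :
    Function.Periodic (fun q : ℝ => groupVelocity ω₂ q) (2 * π) := fun q => groupVelocity_periodic ω₂ q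

/-- `|sin((x + n·2π)/2 )| = |sin(x/2)|`-type reduction: `|sin((a − b)/2)|` only depends on `a − b`
modulo `2π`. [folklore] -/
theorem fibreTwoZeroFloor_abs_sin_half_add_int (x : ℝ) (n : ℤ) :
    |Real.sin ((x + n * (2 * π)) / 2)| = |Real.sin (x / 2)| := by
  rw [show (x + n * (2 * π)) / 2 = x / 2 + n * π by ring, Real.sin_add_int_mul_pi, abs_mul,
    abs_neg_one_zpow, one_mul]

/-! ## 2. The factor `D` and `|Ω|` through the factorisation -/

/-- Upper bound of the positive factor: `D = (Σω)(ω₁ω₂+ω₃ω₄) ≤ 8(ω₂+4)^{3/2}` (`ω² ≤ ω₂ + 4`).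
[folklore] -/
theorem fibreTwoZeroFloor_factor_le {ω₂ : ℝ} (hω : 0 < ω₂) (k₁ k₂ k₃ : ℝ) :
    ((dispersion ω₂ k₁ + dispersion ω₂ k₂ + dispersion ω₂ k₃ + dispersion ω₂ (k₁ + k₂ - k₃)) *
          (dispersion ω₂ k₁ * dispersion ω₂ k₂ + dispersion ω₂ k₃ * dispersion ω₂ (k₁ + k₂ - k₃))) ≤
      8 * ((ω₂ + 4) * Real.sqrt (ω₂ + 4)) := by
  set M := Real.sqrt (ω₂ + 4) with hM
  have hM0 : 0 ≤ M := Real.sqrt_nonneg _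
  have hMsq : M ^ 2 = ω₂ + 4 := by rw [hM, Real.sq_sqrt (by linarith)]
  have hle : ∀ k : ℝ, dispersion ω₂ k ≤ M := fun k => by
    rw [hM, ← Real.sqrt_sq (dispersion_pos hω k).le]
    exact Real.sqrt_le_sqrt (KineticConductivityFinite.dispersion_sq_le hω.le k)
  have h0 : ∀ k : ℝ, 0 ≤ dispersion ω₂ k := fun k => (dispersion_pos hω k).le
  have h1 := hle k₁; have h2 := hle k₂; have h3 := hle k₃; have h4 := hle (k₁ + k₂ - k₃)
  have hsum : dispersion ω₂ k₁ + dispersion ω₂ k₂ + dispersion ω₂ k₃ + dispersion ω₂ (k₁ + k₂ - k₃) ≤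
      4 * M := by linarith
  have hprod : dispersion ω₂ k₁ * dispersion ω₂ k₂ + dispersion ω₂ k₃ * dispersion ω₂ (k₁ + k₂ - k₃) ≤
      2 * M ^ 2 := by
    nlinarith [mul_le_mul h1 h2 (h0 k₂) hM0, mul_le_mul h3 h4 (h0 _) hM0]
  have hP0 : 0 ≤ dispersion ω₂ k₁ * dispersion ω₂ k₂ + dispersion ω₂ k₃ * dispersion ω₂ (k₁ + k₂ - k₃) :=
    add_nonneg (mul_nonneg (h0 _) (h0 _)) (mul_nonneg (h0 _) (h0 _))
  calc _ ≤ (4 * M) * (2 * M ^ 2) :=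
        mul_le_mul hsum hprod hP0 (by linarith)
    _ = 8 * ((ω₂ + 4) * Real.sqrt (ω₂ + 4)) := by rw [hMsq]; ring

/-- `|Ω| ≥ |sin((k₃−k₁)/2) sin((k₂−k₃)/2)|·|H| / (ω₂+4)^{3/2}` from the factorisation `Ω·D = 8σH`
(I1) and `D ≤ 8(ω₂+4)^{3/2}`. [folklore] -/
theorem fibreTwoZeroFloor_abs_resonanceFn_ge {ω₂ : ℝ} (hω : 0 < ω₂) (k₁ k₂ k₃ : ℝ) :
    |Real.sin ((k₃ - k₁) / 2) * Real.sin ((k₂ - k₃) / 2)| *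
        |((dispersion ω₂ k₁ * dispersion ω₂ k₂ + dispersion ω₂ k₃ * dispersion ω₂ (k₁ + k₂ - k₃) +
              2 * (ω₂ + 2)) * Real.cos ((k₁ + k₂) / 2) -
          4 * Real.cos ((k₃ - k₁) / 2) * Real.cos ((k₂ - k₃) / 2))| / ((ω₂ + 4) * Real.sqrt (ω₂ + 4)) ≤
      |resonanceFn ω₂ k₁ k₂ k₃| := by
  have hI := stub_resonanceFactorisation ω₂ hω.le k₁ k₂ k₃
  have hDpos := sheetTransversal_factor_pos hω k₁ k₂ k₃
  have hDle := fibreTwoZeroFloor_factor_le hω k₁ k₂ k₃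
  have hMpos : 0 < (ω₂ + 4) * Real.sqrt (ω₂ + 4) := by
    have : 0 < Real.sqrt (ω₂ + 4) := Real.sqrt_pos.2 (by linarith)
    positivity
  rw [div_le_iff₀ hMpos]
  have habs := congrArg abs hI
  rw [abs_mul, abs_of_pos hDpos] at habs
  -- `|Ω|·D = 8|σ||H|`
  have h8 : |Real.sin ((k₃ - k₁) / 2) * Real.sin ((k₂ - k₃) / 2)| *
      |((dispersion ω₂ k₁ * dispersion ω₂ k₂ + dispersion ω₂ k₃ * dispersion ω₂ (k₁ + k₂ - k₃) +
              2 * (ω₂ + 2)) * Real.cos ((k₁ + k₂) / 2) -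
          4 * Real.cos ((k₃ - k₁) / 2) * Real.cos ((k₂ - k₃) / 2))| =
      |resonanceFn ω₂ k₁ k₂ k₃| *
        ((dispersion ω₂ k₁ + dispersion ω₂ k₂ + dispersion ω₂ k₃ + dispersion ω₂ (k₁ + k₂ - k₃)) *
          (dispersion ω₂ k₁ * dispersion ω₂ k₂ + dispersion ω₂ k₃ * dispersion ω₂ (k₁ + k₂ - k₃))) / 8 := by
    have h8abs : |(8:ℝ)| = 8 := abs_of_pos (by norm_num)
    rw [habs]; simp only [abs_mul, h8abs]; ring
  rw [h8]
  have h0 : 0 ≤ |resonanceFn ω₂ k₁ k₂ k₃| := abs_nonneg _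
  calc |resonanceFn ω₂ k₁ k₂ k₃| *
        ((dispersion ω₂ k₁ + dispersion ω₂ k₂ + dispersion ω₂ k₃ + dispersion ω₂ (k₁ + k₂ - k₃)) *
          (dispersion ω₂ k₁ * dispersion ω₂ k₂ + dispersion ω₂ k₃ * dispersion ω₂ (k₁ + k₂ - k₃))) / 8
      ≤ |resonanceFn ω₂ k₁ k₂ k₃| * (8 * ((ω₂ + 4) * Real.sqrt (ω₂ + 4))) / 8 := by gcongr
    _ = |resonanceFn ω₂ k₁ k₂ k₃| * ((ω₂ + 4) * Real.sqrt (ω₂ + 4)) := by ring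

/-! ## 3. Zeros of `H` on a non-degenerate fibre: existence and one class -/

/-- A zero of the antiperiodic continuous function `H(k₁, ·, k₃)` exists. [folklore] -/
theorem fibreTwoZeroFloor_exists_zero (ω₂ k₁ k₃ : ℝ) :
    ∃ z : ℝ, ((dispersion ω₂ k₁ * dispersion ω₂ z + dispersion ω₂ k₃ * dispersion ω₂ (k₁ + z - k₃) +
              2 * (ω₂ + 2)) * Real.cos ((k₁ + z) / 2) -
          4 * Real.cos ((k₃ - k₁) / 2) * Real.cos ((z - k₃) / 2)) = 0 := by
  set h : ℝ → ℝ := fun q =>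
      ((dispersion ω₂ k₁ * dispersion ω₂ q + dispersion ω₂ k₃ * dispersion ω₂ (k₁ + q - k₃) +
              2 * (ω₂ + 2)) * Real.cos ((k₁ + q) / 2) -
          4 * Real.cos ((k₃ - k₁) / 2) * Real.cos ((q - k₃) / 2)) with hh
  have hc : Continuous h := by
    have hd := levelShift_continuous_dispersion ω₂
    simp only [hh]; fun_prop
  have hanti : h (0 + 2 * π) = -h 0 := by
    simp only [hh]; exact fibreTwoZeroFloor_sheet_add_two_pi ω₂ k₁ 0 k₃
  have hmem : (0 : ℝ) ∈ uIcc (h 0) (h (0 + 2 * π)) := by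
    rw [hanti, mem_uIcc]
    rcases le_or_gt 0 (h 0) with h0 | h0
    · exact Or.inr ⟨by linarith, h0⟩
    · exact Or.inl ⟨h0.le, by linarith⟩
  obtain ⟨z, -, hz⟩ := intermediate_value_uIcc hc.continuousOn hmem
  exact ⟨z, by simpa [hh] using hz⟩

/-- A zero of `H` AT `k₂ = k₃` forces equal velocities `ω′(k₃) = ω′(k₁)` (the velocity identity
`(v₂ − v₄)·D = 8σ·G` of TA at `k₂ = k₃`, where `σ = 0` and `v₄ = v(k₁)`). [folklore] -/
theorem fibreTwoZeroFloor_velocity_eq_of_zero_at_exchange {ω₂ : ℝ} (hω : 0 < ω₂) {k₁ k₃ : ℝ}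
    (hH : ((dispersion ω₂ k₁ * dispersion ω₂ k₃ + dispersion ω₂ k₃ * dispersion ω₂ (k₁ + k₃ - k₃) +
              2 * (ω₂ + 2)) * Real.cos ((k₁ + k₃) / 2) -
          4 * Real.cos ((k₃ - k₁) / 2) * Real.cos ((k₃ - k₃) / 2)) = 0) :
    groupVelocity ω₂ k₃ = groupVelocity ω₂ k₁ := by
  have hv := sheetTransversal_velocity_identity hω (fun q => stub_resonanceFactorisation ω₂ hω.le k₁ q k₃) hH
  have hD := sheetTransversal_factor_pos hω k₁ k₃ k₃
  simp only [sub_self, zero_div, Real.sin_zero, mul_zero, zero_mul, add_sub_cancel_right] at hv hD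
  exact sub_eq_zero.1 ((mul_eq_zero.1 hv).resolve_right hD.ne')

/-- **One zero class.** On a non-degenerate fibre all zeros of `H(k₁, ·, k₃)` are congruent mod `2π`:
they are zeros of `Ω` (I1), none is congruent to the exchange zero `k₃` (previous lemma and periodicity),
and `Ω(k₁, ·, k₃)` has at most two zero classes (`FGRGap…Branch.two_classes`). [folklore] -/
theorem fibreTwoZeroFloor_one_class (ω₂ : ℝ) (hω : 0 < ω₂) (k₁ k₃ z₀ z : ℝ)
    (hsp : Real.sin ((k₃ - k₁) / 2) ≠ 0) (hv : groupVelocity ω₂ k₃ ≠ groupVelocity ω₂ k₁)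
    (hz₀ : ((dispersion ω₂ k₁ * dispersion ω₂ z₀ + dispersion ω₂ k₃ * dispersion ω₂ (k₁ + z₀ - k₃) +
              2 * (ω₂ + 2)) * Real.cos ((k₁ + z₀) / 2) -
          4 * Real.cos ((k₃ - k₁) / 2) * Real.cos ((z₀ - k₃) / 2)) = 0)
    (hz : ((dispersion ω₂ k₁ * dispersion ω₂ z + dispersion ω₂ k₃ * dispersion ω₂ (k₁ + z - k₃) +
              2 * (ω₂ + 2)) * Real.cos ((k₁ + z) / 2) -
          4 * Real.cos ((k₃ - k₁) / 2) * Real.cos ((z - k₃) / 2)) = 0) :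
    ∃ n : ℤ, z - z₀ = n * (2 * π) := by
  have ht : ∀ n : ℤ, k₃ - k₁ ≠ n * (2 * π) := by
    intro n hn
    apply hsp
    rw [hn, show (n : ℝ) * (2 * π) / 2 = n * π by ring]
    exact Real.sin_int_mul_pi n
  have hΩ₀ := sheetTransversal_resonanceFn_eq_zero hω (fun q => stub_resonanceFactorisation ω₂ hω.le k₁ q k₃) hz₀
  have hΩ := sheetTransversal_resonanceFn_eq_zero hω (fun q => stub_resonanceFactorisation ω₂ hω.le k₁ q k₃) hz
  have hk₃ : resonanceFn ω₂ k₁ k₃ k₃ = 0 := resonanceFn_self ω₂ k₁ k₃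
  -- a zero of `H` congruent to `k₃` would sit at `k₃` itself (|H| is periodic), forcing equal velocities
  have hnot : ∀ w : ℝ, ((dispersion ω₂ k₁ * dispersion ω₂ w + dispersion ω₂ k₃ * dispersion ω₂ (k₁ + w - k₃) +
              2 * (ω₂ + 2)) * Real.cos ((k₁ + w) / 2) -
          4 * Real.cos ((k₃ - k₁) / 2) * Real.cos ((w - k₃) / 2)) = 0 →
      ¬ ∃ n : ℤ, w - k₃ = n * (2 * π) := by
    intro w hw ⟨n, hn⟩
    have hper := (fibreTwoZeroFloor_abs_sheet_periodic ω₂ k₁ k₃).int_mul n k₃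
    have hw' : w = k₃ + n * (2 * π) := by linarith
    rw [← hw', hw, abs_zero] at hper
    exact hv (fibreTwoZeroFloor_velocity_eq_of_zero_at_exchange hω (abs_eq_zero.1 hper.symm))
  rcases FGRGap.FoldJetRigidity.Branch.two_classes hω ht hk₃ hΩ₀ hΩ with h1 | h2 | h3
  · exact absurd h1 (hnot z₀ hz₀)
  · exact absurd h2 (hnot z hz)
  · exact h3

/-- **Registered helper (TZ part B): one zero class in closed form** — `fibreTwoZeroFloor_one_class` with
all arguments universally quantified (the shape registered on the crux item). [folklore] -/
theorem fibreTwoZeroFloor_oneClass :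
    ∀ ω₂ : ℝ, 0 < ω₂ → ∀ k₁ k₃ z₀ z : ℝ, Real.sin ((k₃ - k₁) / 2) ≠ 0 →
      groupVelocity ω₂ k₃ ≠ groupVelocity ω₂ k₁ →
      ((dispersion ω₂ k₁ * dispersion ω₂ z₀ + dispersion ω₂ k₃ * dispersion ω₂ (k₁ + z₀ - k₃) +
              2 * (ω₂ + 2)) * Real.cos ((k₁ + z₀) / 2) -
          4 * Real.cos ((k₃ - k₁) / 2) * Real.cos ((z₀ - k₃) / 2)) = 0 →
      ((dispersion ω₂ k₁ * dispersion ω₂ z + dispersion ω₂ k₃ * dispersion ω₂ (k₁ + z - k₃) +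
              2 * (ω₂ + 2)) * Real.cos ((k₁ + z) / 2) -
          4 * Real.cos ((k₃ - k₁) / 2) * Real.cos ((z - k₃) / 2)) = 0 →
      ∃ n : ℤ, z - z₀ = n * (2 * Real.pi) :=
  fun ω₂ hω k₁ k₃ z₀ z hsp hv hz₀ hz => fibreTwoZeroFloor_one_class ω₂ hω k₁ k₃ z₀ z hsp hv hz₀ hz

end Summit.AtomisticToContinuum.FouriersLaw.Theorems.MourreDissolution

end
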